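import Mathlib
import Literature.Computability.Cryptography.PQCWave0
import HarnessLib

/-!
# Harvey's exponent one-fifth factoring algorithm: the proved number theory and the `o(1)` step

D. Harvey, *An exponent one-fifth algorithm for deterministic integer factorisation*,
Math. Comp. **90** (2021), no. 332, 2937–2950, doi:10.1090/mcom/3658, arXiv:2010.05450
(key `Harvey2021`).  The paper proves

> **Theorem 1.1.** There is an integer factorisation algorithm achieving
> `F(N) = O(N^{1/5} log^{16/5} N)`,

where `F(N)` is the number of steps of a deterministic Turing machine with finitely many linear
tapes computing the prime factorisation of `N ≥ 2` (binary encoding).  The statement library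
(`PQCWave0.lean`, **pqc.S09**) vendors its `N^{1/5+o(1)}` corollary as the named fact
`Literature.Computability.Cryptography.harvey_factoring_one_fifth`, rendered in Mathlib's
multi-stack model `Turing.FinTM2` (time = number of TM2 statements, as a function of the input
*length* `n`, so that `N < 2^n`).

Discharging that fact means *building the machine* (quasi-linear polynomial arithmetic over
`ℤ/N`, product trees, Bluestein evaluation, fast multipoint evaluation, merge sort, Strassen's
small-factor test = Prop. 2.5, Hittmeir's large-order element = Prop. 2.7, the Lehman /
baby-step–giant-step search = Props. 4.1–4.3, all as verified stack programs with step counts),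
which is a theory of its own.  This file proves, once and for all, the parts of the paper that
are *mathematics rather than machines*:

* the **`o(1)` bookkeeping** from the printed bound to **pqc.S09**:
  `harvey_factoring_one_fifth_of_time_bound` — any TM2 factoring machine with
  `time n ≤ C · (2^{n/5} n^{16/5} + 1)` (the per-length form of `O(N^{1/5} log^{16/5} N)`, `n`
  the bit length) witnesses `harvey_factoring_one_fifth`, because
  `2^{n/5} n^{16/5} + 1 ≤ (24/(ε log 2)⁴ + 1) · 2^{(1/5+ε) n}` (`main_term_le`);
* **Lemma 3.1** (journal) = Lemma 10 (arXiv): `aq` and `bp` are the roots of `y² − uy + abN`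
  (`lemma31_quadratic`, `lemma31_discriminant`), and `p` is recovered by one gcd
  (`lemma31_recover`);
* **Lemma 3.3** (journal) = Lemma 12 (arXiv), Lehman's lemma in Harvey's form, with the printed
  proof: Dirichlet's approximation theorem (Hardy–Wright Thm 36 = Mathlib's
  `Real.exists_int_int_abs_mul_sub_le`) for `ξ = p/q`, `n = ⌊(qr/p)^{1/2}⌋`, then AM–GM
  (`lemma33_lehman`, real-variable core `lehman_core`);
* the congruence `α^{aq+bp} = α^{aN+b}` in `ℤ/p` driving the main search, proof of
  **Prop. 4.2** = arXiv Prop. 15 (`pow_aq_add_bp`), and the gcd criterion and step (3c) of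
  Algorithm 1, proof of **Prop. 4.1** = arXiv Prop. 14 (`gcd_prod_sub_ne_one_iff`,
  `exists_not_isUnit_of_prod_eq_zero`).

Numbering: the journal numbers results within sections (Thm 1.1; Lem 2.1, Rem 2.2, Lem 2.3,
Lem 2.4, Prop 2.5, Rem 2.6, Prop 2.7, Rem 2.8; Lem 3.1, Rem 3.2, Lem 3.3, Rem 3.4; Prop 4.1–4.3 —
anchor: Harvey–Hittmeir, Math. Comp. 91 (2022), proof of their Prop. 4.2: "This is exactly
Proposition 4.1 in [Har-onefifth]"); the arXiv text uses one counter (Thm 1, Lem 2, Rem 3,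
Lem 4, Lem 5, Prop 6, Rem 7, Prop 8, Rem 9, Lem 10, Rem 11, Lem 12, Rem 13, Prop 14, Prop 15,
Prop 16).  Docstrings give both.

What is NOT here (deliberately, D-0026: no new named facts): the machine-level statements
Thm 1.1, Props 2.5, 2.7, 4.1–4.3 and Lemmas 2.1/2.3/2.4; they are to be *proved* with the
stack-program toolkit (`Complexity/StackPrograms.lean`, `StackMachinesTM2.lean`, …), bottom-up.
-/

open Real Finset

namespace Literature.Computability.Cryptography

open Turing _root_.Computability

namespace Harvey2021

/-! ### From the printed bound to **pqc.S09**: the `o(1)` bookkeeping -/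

/-- Polynomial versus exponential, explicitly: `x⁴ ≤ 24 / (ε log 2)⁴ · 2^{ε x}` for `x ≥ 0`,
`ε > 0` (from `y⁴/4! ≤ e^y`, Mathlib's `Real.pow_div_factorial_le_exp`). [folklore] -/
theorem pow_four_le_two_rpow {ε : ℝ} (hε : 0 < ε) {x : ℝ} (hx : 0 ≤ x) :
    x ^ 4 ≤ 24 / (ε * Real.log 2) ^ 4 * (2 : ℝ) ^ (ε * x) := by
  have hL : 0 < Real.log 2 := Real.log_pos one_lt_two
  have hc : 0 < ε * Real.log 2 := mul_pos hε hL
  have h := Real.pow_div_factorial_le_exp (x := ε * Real.log 2 * x) (by positivity) 4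
  have h2 : Real.exp (ε * Real.log 2 * x) = (2 : ℝ) ^ (ε * x) := by
    rw [Real.rpow_def_of_pos two_pos]
    ring_nf
  have h24 : ((Nat.factorial 4 : ℕ) : ℝ) = 24 := by norm_num [Nat.factorial]
  rw [h24, div_le_iff₀ (by norm_num : (0 : ℝ) < 24), h2] at h
  rw [div_mul_eq_mul_div, le_div_iff₀ (pow_pos hc 4)]
  calc x ^ 4 * (ε * Real.log 2) ^ 4 = (ε * Real.log 2 * x) ^ 4 := by ring
    _ ≤ 2 ^ (ε * x) * 24 := h
    _ = 24 * 2 ^ (ε * x) := mul_comm _ _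

/-- `n^{16/5} ≤ n⁴` for natural `n`. [folklore] -/
theorem rpow_sixteen_fifths_le_pow_four (n : ℕ) : (n : ℝ) ^ ((16 : ℝ) / 5) ≤ (n : ℝ) ^ 4 := by
  rcases Nat.eq_zero_or_pos n with rfl | hn
  · simp [Real.zero_rpow (by norm_num : (16 : ℝ) / 5 ≠ 0)]
  · have h1 : (1 : ℝ) ≤ n := by exact_mod_cast hn
    calc (n : ℝ) ^ ((16 : ℝ) / 5) ≤ (n : ℝ) ^ ((4 : ℕ) : ℝ) :=
          Real.rpow_le_rpow_of_exponent_le h1 (by norm_num)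
      _ = (n : ℝ) ^ 4 := Real.rpow_natCast _ _

/-- The `o(1)` bookkeeping: `2^{n/5} n^{16/5} + 1 ≤ (24/(ε log 2)⁴ + 1) · 2^{(1/5+ε) n}` for every
`ε > 0` and `n : ℕ` — i.e. `N^{1/5} log^{16/5} N = N^{1/5+o(1)}` with explicit constants,
`n` being the bit length of `N`. [folklore] -/
theorem main_term_le (ε : ℝ) (hε : 0 < ε) (n : ℕ) :
    (2 : ℝ) ^ ((n : ℝ) / 5) * (n : ℝ) ^ ((16 : ℝ) / 5) + 1
      ≤ (24 / (ε * Real.log 2) ^ 4 + 1) * (2 : ℝ) ^ ((1 / 5 + ε) * n) := by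
  set A : ℝ := 24 / (ε * Real.log 2) ^ 4 with hA
  have h2pos : (0 : ℝ) < 2 := two_pos
  have hsplit : (2 : ℝ) ^ ((1 / 5 + ε) * n) = 2 ^ ((n : ℝ) / 5) * 2 ^ (ε * n) := by
    rw [← Real.rpow_add h2pos]
    ring_nf
  have hn4 : (n : ℝ) ^ ((16 : ℝ) / 5) ≤ A * 2 ^ (ε * n) :=
    (rpow_sixteen_fifths_le_pow_four n).trans (pow_four_le_two_rpow hε (Nat.cast_nonneg n))
  have hone : (1 : ℝ) ≤ 2 ^ ((1 / 5 + ε) * n) := Real.one_le_rpow one_le_two (by positivity)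
  have h25 : (0 : ℝ) ≤ 2 ^ ((n : ℝ) / 5) := (Real.rpow_pos_of_pos h2pos _).le
  calc (2 : ℝ) ^ ((n : ℝ) / 5) * (n : ℝ) ^ ((16 : ℝ) / 5) + 1
      ≤ 2 ^ ((n : ℝ) / 5) * (A * 2 ^ (ε * n)) + 2 ^ ((1 / 5 + ε) * n) :=
        add_le_add (mul_le_mul_of_nonneg_left hn4 h25) hone
    _ = (A + 1) * 2 ^ ((1 / 5 + ε) * n) := by rw [hsplit]; ring

/-- **From Theorem 1.1 as printed to pqc.S09.**  Harvey's Theorem 1.1 (journal) = Theorem 1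
(arXiv:2010.05450) states `F(N) = O(N^{1/5} log^{16/5} N)`; for inputs of bit length `n`
(`2^{n-1} ≤ N < 2^n`) this is, uniformly up to constants, a per-length bound
`C · (2^{n/5} n^{16/5} + 1)` on the running time (the `+ 1` covering `N ∈ {0, 1}`).  Any TM2
factoring machine `M` (`Turing.TM2ComputableInTime encodeNat encodeListNat Nat.primeFactorsList`)
obeying such a bound witnesses the vendored `N^{1/5+o(1)}` fact
`Literature.Computability.Cryptography.harvey_factoring_one_fifth`, with the same machine and
`C_ε = |C| · (24/(ε log 2)⁴ + 1)`.  This isolates the analytic step; the machine itself is the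
content of the paper. [cite: Harvey2021, Thm 1.1 (arXiv Thm 1)] -/
theorem harvey_factoring_one_fifth_of_time_bound
    (M : TM2ComputableInTime encodeNat encodeListNat Nat.primeFactorsList) (C : ℝ)
    (hC : ∀ n : ℕ, (M.time n : ℝ) ≤ C * ((2 : ℝ) ^ ((n : ℝ) / 5) * (n : ℝ) ^ ((16 : ℝ) / 5) + 1)) :
    harvey_factoring_one_fifth := by
  refine ⟨M, fun ε hε => ⟨|C| * (24 / (ε * Real.log 2) ^ 4 + 1), fun n => ?_⟩⟩
  have key := main_term_le ε hε n
  have hX : (0 : ℝ) ≤ 2 ^ ((n : ℝ) / 5) * (n : ℝ) ^ ((16 : ℝ) / 5) + 1 := by positivity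
  calc (M.time n : ℝ) ≤ C * (2 ^ ((n : ℝ) / 5) * (n : ℝ) ^ ((16 : ℝ) / 5) + 1) := hC n
    _ ≤ |C| * (2 ^ ((n : ℝ) / 5) * (n : ℝ) ^ ((16 : ℝ) / 5) + 1) :=
        mul_le_mul_of_nonneg_right (le_abs_self C) hX
    _ ≤ |C| * ((24 / (ε * Real.log 2) ^ 4 + 1) * 2 ^ ((1 / 5 + ε) * n)) :=
        mul_le_mul_of_nonneg_left key (abs_nonneg C)
    _ = |C| * (24 / (ε * Real.log 2) ^ 4 + 1) * 2 ^ ((1 / 5 + ε) * n) := by ring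

/-! ### §3: Lehman's strategy -/

/-- **Harvey 2021, Lemma 3.1** (journal) = Lemma 10 (arXiv), the algebra: if `u = aq + bp` and
`N = pq` then `aq` and `bp` are the roots of `Q(y) = y² − uy + abN`, i.e.
`(y − aq)(y − bp) = y² − (aq + bp) y + ab(pq)` identically.
[cite: Harvey2021, Lem. 3.1 (arXiv Lem. 10)] -/
theorem lemma31_quadratic (a b p q y : ℤ) :
    (y - a * q) * (y - b * p) = y ^ 2 - (a * q + b * p) * y + a * b * (p * q) := by
  ring

/-- **Harvey 2021, Lemma 3.1**, the test: the discriminant `u² − 4abN` of `Q` is the perfect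
square `(aq − bp)²` (the algorithm tests whether `u² − 4abN` is a square and takes the roots
`(u ± √·)/2`). [cite: Harvey2021, Lem. 3.1 (arXiv Lem. 10)] -/
theorem lemma31_discriminant (a b p q : ℤ) :
    (a * q + b * p) ^ 2 - 4 * (a * b * (p * q)) = (a * q - b * p) ^ 2 := by
  ring

/-- **Harvey 2021, Lemma 3.1**, the recovery ("it is then straightforward to recover `p` and
`q`"): from the root `bp` one gcd with `N = pq` gives `p`, provided `0 < b < q` with `q` prime
(in Algorithm 2, `b ≤ r < q`): `gcd(pq, bp) = p`. [cite: Harvey2021, Lem. 3.1 (arXiv Lem. 10)] -/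
theorem lemma31_recover {p q b : ℕ} (hq : q.Prime) (hb : 0 < b) (hbq : b < q) :
    Nat.gcd (p * q) (b * p) = p := by
  have hcop : Nat.Coprime q b :=
    (Nat.Prime.coprime_iff_not_dvd hq).2 fun h => absurd (Nat.le_of_dvd hb h) (not_le.2 hbq)
  rw [mul_comm b p, Nat.gcd_mul_left, Nat.coprime_iff_gcd_eq_one.1 hcop, mul_one]

/-- The real-variable core of the last step of Lemma 3.3: if `P B² = Q R` and
`|yP − xQ| < Q / B` (all quantities positive), then
`0 ≤ xQ + yP − (4xy·PQ)^{1/2} < (PQ)^{1/2} / (4 R (xy)^{1/2})` — AM–GM for the lower bound and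
`u − s = (u² − s²)/(u + s) ≤ (yP − xQ)²/(2s)`, `(yP − xQ)² < Q²/B² = PQ/R` for the upper bound.
[cite: Harvey2021, proof of Lem. 3.3 (arXiv Lem. 12)] -/
theorem lehman_core {P Q R x y B : ℝ} (hP : 0 < P) (hQ : 0 < Q) (hR : 0 < R) (hx : 0 < x)
    (hy : 0 < y) (hB0 : 0 < B) (hB : P * B ^ 2 = Q * R) (hd : |y * P - x * Q| < Q / B) :
    0 ≤ x * Q + y * P - Real.sqrt (4 * (x * y) * (P * Q)) ∧
      x * Q + y * P - Real.sqrt (4 * (x * y) * (P * Q)) <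
        Real.sqrt (P * Q) / (4 * R * Real.sqrt (x * y)) := by
  obtain ⟨u, hu⟩ : ∃ u : ℝ, u = x * Q + y * P := ⟨_, rfl⟩
  obtain ⟨s, hs⟩ : ∃ s : ℝ, s = Real.sqrt (4 * (x * y) * (P * Q)) := ⟨_, rfl⟩
  obtain ⟨w, hw⟩ : ∃ w : ℝ, w = Real.sqrt (x * y) := ⟨_, rfl⟩
  obtain ⟨v, hv⟩ : ∃ v : ℝ, v = Real.sqrt (P * Q) := ⟨_, rfl⟩
  rw [← hu, ← hs, ← hw, ← hv]
  have hxy : 0 < x * y := mul_pos hx hy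
  have hPQ : 0 < P * Q := mul_pos hP hQ
  have hu0 : 0 < u := by rw [hu]; positivity
  have hw0 : 0 < w := by rw [hw]; exact Real.sqrt_pos.2 hxy
  have hv0 : 0 < v := by rw [hv]; exact Real.sqrt_pos.2 hPQ
  have hw2 : w ^ 2 = x * y := by rw [hw]; exact Real.sq_sqrt hxy.le
  have hv2 : v ^ 2 = P * Q := by rw [hv]; exact Real.sq_sqrt hPQ.le
  -- `s = 2 w v`, `s ≤ u`, `u² − s² = (yP − xQ)²`
  have hs' : s = 2 * w * v := by
    rw [hs, show (4 : ℝ) * (x * y) * (P * Q) = (2 * w * v) ^ 2 by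
      rw [mul_pow, mul_pow, hw2, hv2]; norm_num]
    exact Real.sqrt_sq (by positivity)
  have hs2 : s ^ 2 = 4 * (x * y) * (P * Q) := by rw [hs', mul_pow, mul_pow, hw2, hv2]; norm_num
  have hus : u ^ 2 - s ^ 2 = (y * P - x * Q) ^ 2 := by rw [hs2, hu]; ring
  have hsu : s ≤ u := by
    have h0s : 0 ≤ s := by rw [hs']; positivity
    nlinarith [sq_nonneg (y * P - x * Q), hus]
  refine ⟨sub_nonneg.2 hsu, ?_⟩
  -- `(yP − xQ)² < PQ / R`
  have hd2 : (y * P - x * Q) ^ 2 < P * Q / R := by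
    have hlt := abs_lt.1 hd
    have e2 : (y * P - x * Q) ^ 2 < (Q / B) ^ 2 := sq_lt_sq' hlt.1 hlt.2
    have e3 : (Q / B) ^ 2 = P * Q / R := by
      rw [div_pow, div_eq_div_iff (pow_ne_zero 2 hB0.ne') hR.ne']
      linear_combination (-Q) * hB
    rwa [e3] at e2
  -- `(u − s) · 4wv ≤ (u − s)(u + s) = (yP − xQ)² < PQ/R = v²/R`
  have h1 : (u - s) * (4 * w * v) ≤ (y * P - x * Q) ^ 2 := by
    rw [← hus, show u ^ 2 - s ^ 2 = (u - s) * (u + s) by ring]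
    refine mul_le_mul_of_nonneg_left ?_ (sub_nonneg.2 hsu)
    rw [hs'] at hsu ⊢
    linarith
  have h2 : (u - s) * (4 * w * v) * R < v ^ 2 := by
    rw [hv2]
    exact (lt_div_iff₀ hR).1 (h1.trans_lt hd2)
  rw [lt_div_iff₀ (by positivity : (0 : ℝ) < 4 * R * w)]
  have h3 : (u - s) * (4 * R * w) * v < v * v := by
    calc (u - s) * (4 * R * w) * v = (u - s) * (4 * w * v) * R := by ring
      _ < v ^ 2 := h2
      _ = v * v := sq v
  exact lt_of_mul_lt_mul_right h3 hv0.le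

/-- **Harvey 2021, Lemma 3.3** (journal) = Lemma 12 (arXiv) (Lehman's lemma in Harvey's form):
let `p, q, r` be positive integers and `N = pq` with `(N/r)^{1/2} ≤ p < N^{1/2}`; then there are
positive integers `a, b` with `ab ≤ r` such that
`0 ≤ aq + bp − (4abN)^{1/2} < N^{1/2} / (4 r (ab)^{1/2})`.
Proof as printed: Dirichlet's approximation theorem (Hardy–Wright Thm 36; Mathlib
`Real.exists_int_int_abs_mul_sub_le`) applied to `ξ = p/q` and `n = ⌊B⌋`, `B = (qr/p)^{1/2}`,
gives `a/b` with `1 ≤ b ≤ n` and `|a/b − p/q| < 1/(Bb)`; then `a > 0`, `ab ≤ r`, and the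
AM–GM estimate (`lehman_core`). [cite: Harvey2021, Lem. 3.3 (arXiv Lem. 12)] -/
theorem lemma33_lehman {N p q r : ℕ} (hp : 0 < p) (hq : 0 < q) (hr : 0 < r) (hN : N = p * q)
    (hlow : Real.sqrt (N / r) ≤ p) (hup : (p : ℝ) < Real.sqrt N) :
    ∃ a b : ℕ, 0 < a ∧ 0 < b ∧ a * b ≤ r ∧
      0 ≤ (a * q + b * p : ℝ) - Real.sqrt (4 * (a * b) * N) ∧
      (a * q + b * p : ℝ) - Real.sqrt (4 * (a * b) * N) <
        Real.sqrt N / (4 * r * Real.sqrt (a * b)) := by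
  subst hN
  push_cast at hlow hup ⊢
  have hp' : (0 : ℝ) < p := by exact_mod_cast hp
  have hq' : (0 : ℝ) < q := by exact_mod_cast hq
  have hr' : (0 : ℝ) < r := by exact_mod_cast hr
  have hq0 : (q : ℝ) ≠ 0 := hq'.ne'
  -- `p < q` and `q ≤ p r`
  have hpq : (p : ℝ) < q := by
    have h := (Real.lt_sqrt hp'.le).1 hup
    nlinarith
  have hqpr : (q : ℝ) ≤ p * r := by
    have h := (Real.sqrt_le_left hp'.le).1 hlow
    rw [div_le_iff₀ hr'] at h
    nlinarith
  -- `B = √(qr/p) ≥ 1`, `n = ⌊B⌋ ≥ 1`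
  obtain ⟨B, hB⟩ : ∃ B : ℝ, B = Real.sqrt (q * r / p) := ⟨_, rfl⟩
  have hBpos : 0 < B := by rw [hB]; exact Real.sqrt_pos.2 (by positivity)
  have hB2 : B ^ 2 = q * r / p := by rw [hB]; exact Real.sq_sqrt (by positivity)
  have hB2' : (p : ℝ) * B ^ 2 = q * r := by rw [hB2]; field_simp
  have hB1 : 1 ≤ B := by
    rw [hB, Real.le_sqrt' one_pos, one_pow, le_div_iff₀ hp']
    nlinarith
  obtain ⟨n, hn⟩ : ∃ n : ℕ, n = ⌊B⌋₊ := ⟨_, rfl⟩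
  have hn1 : 0 < n := by rw [hn]; exact Nat.floor_pos.2 hB1
  have hnB : (n : ℝ) ≤ B := by rw [hn]; exact Nat.floor_le hBpos.le
  have hBn : B < n + 1 := by rw [hn]; exact Nat.lt_floor_add_one B
  -- `q ≤ p B`, i.e. `1/B ≤ p/q`
  have hqpB : (q : ℝ) ≤ p * B := by
    have h1 : (q : ℝ) ^ 2 ≤ (p * B) ^ 2 := by nlinarith
    exact (sq_le_sq₀ hq'.le (by positivity)).1 h1
  have hxi : 1 / B ≤ (p : ℝ) / q := by
    rw [div_le_div_iff₀ hBpos hq', one_mul]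
    exact hqpB
  -- Dirichlet's approximation theorem for `ξ = p/q`
  obtain ⟨j, k, hk0, hkn, hjk⟩ := Real.exists_int_int_abs_mul_sub_le ((p : ℝ) / q) hn1
  have hlt : |(k : ℝ) * (p / q) - j| < 1 / B :=
    hjk.trans_lt (one_div_lt_one_div_of_lt hBpos hBn)
  have habs := abs_lt.1 hlt
  have hk1 : (1 : ℝ) ≤ k := by exact_mod_cast hk0
  have hkB : (k : ℝ) ≤ B := le_trans (by exact_mod_cast hkn) hnB
  have hξ : (0 : ℝ) < p / q := div_pos hp' hq'
  have hjpos : (0 : ℝ) < j := by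
    have : (p : ℝ) / q ≤ k * (p / q) := le_mul_of_one_le_left hξ.le hk1
    linarith [habs.2]
  have hj0 : (0 : ℤ) < j := by exact_mod_cast hjpos
  -- pass to natural numbers `a = j`, `b = k`
  lift j to ℕ using hj0.le
  lift k to ℕ using hk0.le
  push_cast at habs hlt hk1 hkB hjpos hj0 hk0
  have hk0' : (0 : ℝ) < k := by exact_mod_cast hk0
  refine ⟨j, k, by exact_mod_cast hj0, by exact_mod_cast hk0, ?_, ?_⟩
  · -- `ab ≤ r`: `jk < (k p/q + 1/B) k = k² p/q + k/B ≤ B² p/q + 1 = r + 1`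
    have hlt' : (j : ℝ) * k < r + 1 := by
      have h1 : (j : ℝ) < k * (p / q) + 1 / B := by linarith [habs.1]
      calc (j : ℝ) * k < (k * (p / q) + 1 / B) * k := mul_lt_mul_of_pos_right h1 hk0'
        _ = k ^ 2 * (p / q) + k / B := by ring
        _ ≤ B ^ 2 * (p / q) + 1 := by
            gcongr
            rwa [div_le_one hBpos]
        _ = r + 1 := by rw [hB2]; field_simp
    have h2 : j * k < r + 1 := by exact_mod_cast hlt'
    omega
  · -- the two inequalities, from `lehman_core` with `x = j`, `y = k`
    have hd : |(k : ℝ) * p - j * q| < q / B := by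
      have h1 : |((k : ℝ) * (p / q) - j) * q| < 1 / B * q := by
        rw [abs_mul, abs_of_pos hq']
        exact mul_lt_mul_of_pos_right hlt hq'
      have h2 : ((k : ℝ) * (p / q) - j) * q = k * p - j * q := by
        rw [sub_mul, mul_assoc, div_mul_cancel₀ _ hq0]
      have h3 : 1 / B * (q : ℝ) = q / B := by ring
      rwa [h2, h3] at h1
    exact lehman_core hp' hq' hr' hjpos hk0' hBpos hB2' hd

/-! ### §4: the congruences behind Algorithms 1 and 2 -/

/-- The congruence driving the main search (proof of **Prop. 4.2** = arXiv Prop. 15, following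
Hittmeir and Lehman): for a prime `p`, `N = pq` and any `α`, `α^{aq+bp} = α^{aN+b}` in `ℤ/p`,
"since `p ≡ 1 (mod p−1)` and `α^{p−1} ≡ 1 (mod p)`" — here from `α^p = α` (`ZMod.pow_card`),
so no coprimality hypothesis is needed. [cite: Harvey2021, proof of Prop. 4.2 (arXiv Prop. 15)] -/
theorem pow_aq_add_bp {p : ℕ} [Fact p.Prime] (q a b : ℕ) (α : ZMod p) :
    α ^ (a * q + b * p) = α ^ (a * (p * q) + b) := by
  have h1 : ∀ m : ℕ, α ^ (m * p) = α ^ m := fun m => by rw [pow_mul, ZMod.pow_card]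
  calc α ^ (a * q + b * p) = α ^ (a * q) * α ^ (b * p) := pow_add _ _ _
    _ = α ^ (a * q * p) * α ^ b := by rw [h1 b, h1 (a * q)]
    _ = α ^ (a * (p * q) + b) := by rw [← pow_add]; ring_nf

/-- The gcd criterion behind Algorithm 1 (**Prop. 4.1** = arXiv Prop. 14, correctness): for
`N = pq` with `p, q` prime and integers `β, v₁, …, vₙ`, the product `f(β) = ∏ₕ (β − vₕ)` has a
nontrivial gcd with `N` — `gcd(f(β), N) ≠ 1` — iff some `vₕ ≡ β` modulo `p` or modulo `q`.
[cite: Harvey2021, Prop. 4.1 (arXiv Prop. 14)] -/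
theorem gcd_prod_sub_ne_one_iff {p q : ℕ} (hp : p.Prime) (hq : q.Prime) {ι : Type*}
    (s : Finset ι) (v : ι → ℤ) (β : ℤ) :
    Int.gcd (∏ h ∈ s, (β - v h)) (p * q) ≠ 1 ↔
      ∃ h ∈ s, (p : ℤ) ∣ β - v h ∨ (q : ℤ) ∣ β - v h := by
  have hp' : Prime (p : ℤ) := Nat.prime_iff_prime_int.1 hp
  have hq' : Prime (q : ℤ) := Nat.prime_iff_prime_int.1 hq
  rw [Ne, ← Int.isCoprime_iff_gcd_eq_one, IsCoprime.mul_right_iff, not_and_or]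
  have key : ∀ {r : ℤ}, Prime r →
      (¬IsCoprime (∏ h ∈ s, (β - v h)) r ↔ ∃ h ∈ s, r ∣ β - v h) := by
    intro r hr
    rw [isCoprime_comm, hr.coprime_iff_not_dvd, not_not]
    exact hr.dvd_finsetProd_iff _
  rw [key hp', key hq']
  constructor
  · rintro (⟨h, hh, hd⟩ | ⟨h, hh, hd⟩)
    exacts [⟨h, hh, Or.inl hd⟩, ⟨h, hh, Or.inr hd⟩]
  · rintro ⟨h, hh, hd | hd⟩
    exacts [Or.inl ⟨h, hh, hd⟩, Or.inr ⟨h, hh, hd⟩]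

/-- Step (3c) of Algorithm 1 (proof of **Prop. 4.1** = arXiv Prop. 14): if `N ∣ f(β) = ∏ₕ (β − vₕ)`,
i.e. the product vanishes in `ℤ/N` (`N > 1`), then some factor `β − vₕ` is a non-unit of `ℤ/N`
(a product of units is a unit), so one of the gcds `gcd(N, vₕ − β)` is nontrivial — it is not
`N` because `vₕ ≠ β` in `ℤ/N` by the precondition of the algorithm.
[cite: Harvey2021, proof of Prop. 4.1 (arXiv Prop. 14)] -/
theorem exists_not_isUnit_of_prod_eq_zero {N : ℕ} (hN : 1 < N) {ι : Type*} (l : List ι)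
    (v : ι → ZMod N) (β : ZMod N) (h0 : (l.map fun h => β - v h).prod = 0) :
    ∃ h ∈ l, ¬IsUnit (β - v h) := by
  haveI : Nontrivial (ZMod N) := ZMod.nontrivial_iff.2 hN.ne'
  by_contra hall
  have hall' : ∀ h ∈ l, IsUnit (β - v h) := by simpa using hall
  have hu : IsUnit (l.map fun h => β - v h).prod :=
    List.prod_isUnit_iff.2 fun x hx => by
      obtain ⟨h, hh, rfl⟩ := List.mem_map.1 hx
      exact hall' h hh
  rw [h0] at hu
  exact not_isUnit_zero hu

end Harvey2021

end Literature.Computability.Cryptography
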